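import Summits.BirchSwinnertonDyer.BirchSwinnertonDyer.Theorems.ThetaPartnerAtTwoSignedTransportAtTwoHondaHom
import Summits.BirchSwinnertonDyer.Rank1Residual.Additive.PadicLayerTransport
import HarnessLib

/-!
# The Honda map on `E₁(ℚ̄_p)`: an injective, `Gal(ℚ̄_p/ℚ_p)`-equivariant homomorphism `Ŵ(𝔪̄) → Â(𝔪̄)` — for the crux
# `SignedTransportAtTwo` (stmt-BirchSwinnertonDyer-20333, route `ThetaPartnerAtTwo`, line `bridge` v16, stub `stub_sel2Tb`,
# steps T2/T4) (lead prover bsd-wall-tp2-p1 g5; `--supports stmt-BirchSwinnertonDyer-20333`; route-independent, closes nothing)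

HONEST FRAMING. THEOREMS ONLY (no definition); nothing about any Selmer group is asserted; BSD is not proved by any of this.
No import of any route file.

WHAT. `Ω = ℚ̄_p` (Mathlib `PadicAlgCl p`), `M_W, M_A / ℤ_p` with elliptic generic fibres, `ψ ∈ Xℤ_p⟦X⟧` with
`log_A ∘ ψ = log_W` (p544432 at `p = 2`). `E₁(Ω) = FormalGroupChart.kernel` of `M ⊗ Ω`. The file `…HondaHom` evaluated `ψ` on
`E₁(K)` for COMPLETE `K`; `Ω` is not complete, but every point of `E₁(Ω)` has its parameter `z(P)` in a finite, hence complete,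
extension `ℚ_p(z(P)) ⊂ Ω` (§1: points of `E₁(Ω)` come from `E₁(F)` for `F ⊂ Ω` finite over `ℚ_p`, `exists_map_ptOf_eq`), and
the value `ψ(z(P)) = ∑ ψₙ z(P)ⁿ ∈ Ω` does not depend on the field (§2, `val_ev₁_eq_tsum`). Hence (§3,
**`exists_hondaMapΩ`**): there is an additive `Φ : E₁(W ⊗ Ω) → (A ⊗ Ω)(Ω)` with values in `E₁`, characterised by
`z(Φ P) = ∑ ψₙ z(P)ⁿ`, INJECTIVE, and EQUIVARIANT for every `σ ∈ Aut(Ω/ℚ_p)` (`σ` is an isometry, `spectralNorm_eq_of_equiv`,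
so it commutes with the series). This is Kobayashi 2003 §8 / B. D. Kim 2009 Prop. 2.11–2.12 "`Ê(𝔪̄) ≅ Ê'(𝔪̄)` as Galois
modules" for curves with the same `a_p`, for every prime `p`.

References: [Kobayashi2003] Thm. 8.4, §8.4; [BDKim2009] Prop. 2.11–2.12 (p. 186); [Honda1970] Thm. 2;
[SilvermanAEC2009] IV.2, VII.2.2.
-/

set_option autoImplicit false
-- D-0017: single-problem summit, so `Summit.BirchSwinnertonDyer.BirchSwinnertonDyer.…` repeats a namespace BY DESIGN.
set_option linter.dupNamespace false

noncomputable section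

open scoped Classical NNReal Topology


open PowerSeries WeierstrassCurve Literature.RingTheory.FormalGroups Literature.NumberTheory.EllipticCurves
  Literature.NumberTheory.EllipticCurves.FormalGroupChart
  Summit.BirchSwinnertonDyer.Rank1Residual.Additive Summit.BirchSwinnertonDyer.Rank1Residual.Additive.BallEval
  Literature.NumberTheory.GaloisRepresentations.LubinTate

namespace Summit.BirchSwinnertonDyer.BirchSwinnertonDyer.Theorems.SignedTransportAtTwo

variable {p : ℕ} [hp : Fact p.Prime]

/-! ## §1 Points of `E₁(Ω)` come from complete subfields -/

section Subfield

variable (M : WeierstrassCurve ℤ_[p]) (F : IntermediateField ℚ_[p] (PadicAlgCl p)) [CompleteSpace F]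

omit [CompleteSpace F] in
/-- Nonsingularity transfers along `F ⊂ Ω`. [folklore] -/
theorem nonsingular_val {x y : F} (h : (curveK p F M).toAffine.Nonsingular x y) :
    ((M.map (PadicInt.Coe.ringHom (p := p))).baseChange (PadicAlgCl p)).toAffine.Nonsingular (x : PadicAlgCl p) y :=
  (Affine.baseChange_nonsingular (W := (M.map (PadicInt.Coe.ringHom (p := p))).toAffine)
    (f := IntermediateField.val F) Subtype.val_injective x y).mpr h

omit [CompleteSpace F] in
/-- The map `E(F) → E(Ω)` on an affine point. [folklore] -/
theorem map_val_some {x y : F} (h : (curveK p F M).toAffine.Nonsingular x y) :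
    Affine.Point.map (W' := M.map (PadicInt.Coe.ringHom (p := p))) (IntermediateField.val F)
        (Affine.Point.some x y h : (curveK p F M).toAffine.Point) =
      .some (x : PadicAlgCl p) (y : PadicAlgCl p) (nonsingular_val M F h) := rfl

omit [CompleteSpace F] in
/-- `z` commutes with `E(F) → E(Ω)`. [folklore] -/
theorem zCoord_map_val (P : (curveK p F M).toAffine.Point) :
    (Affine.Point.map (W' := M.map (PadicInt.Coe.ringHom (p := p))) (IntermediateField.val F) P).zCoord =
      ((P.zCoord : F) : PadicAlgCl p) := by
  rcases P with _ | ⟨x, y, h⟩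
  · change (0 : ((M.map (PadicInt.Coe.ringHom (p := p))).baseChange (PadicAlgCl p)).toAffine.Point).zCoord =
      (((0 : (curveK p F M).toAffine.Point).zCoord : F) : PadicAlgCl p)
    rw [Affine.Point.zCoord_zero, Affine.Point.zCoord_zero]; rfl
  · rw [map_val_some, Affine.Point.zCoord_some]
    change _ = (((-x / y : F) : F) : PadicAlgCl p)
    push_cast
    rfl

omit [CompleteSpace F] in
/-- **Kernel ↔ kernel** along `F ⊂ Ω`. [folklore] -/
theorem map_val_mem_kernel_iff
    [((M.map (PadicInt.Coe.ringHom (p := p))).baseChange (PadicAlgCl p)).IsIntegral (Valued.v (R := PadicAlgCl p)).integer]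
    [(curveK p F M).IsIntegral (NormedField.valuation (K := F)).integer] (P : (curveK p F M).toAffine.Point) :
    Affine.Point.map (W' := M.map (PadicInt.Coe.ringHom (p := p))) (IntermediateField.val F) P ∈
        kernel (Valued.v (R := PadicAlgCl p)) ((M.map (PadicInt.Coe.ringHom (p := p))).baseChange (PadicAlgCl p)) ↔
      P ∈ kernel (NormedField.valuation (K := F)) (curveK p F M) := by
  rcases P with _ | ⟨x, y, h⟩
  · exact ⟨fun _ _ _ _ h0 ↦ (WeierstrassCurve.Affine.Point.some_ne_zero _ h0.symm).elim,
      fun _ ↦ (kernel (Valued.v (R := PadicAlgCl p)) ((M.map (PadicInt.Coe.ringHom (p := p))).baseChange (PadicAlgCl p))).zero_mem⟩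
  · rw [map_val_some, some_mem_kernel_iff, some_mem_kernel_iff, PadicAlgCl.valuation_def, ← NNReal.coe_lt_coe,
      coe_nnnorm, NNReal.coe_one, ← NNReal.coe_lt_coe, NormedField.valuation_apply, coe_nnnorm, NNReal.coe_one]
    rfl

variable [hE : (M.map PadicInt.Coe.ringHom).IsElliptic]

/-- **Every point of `E₁(Ω)` whose parameter lies in `F` comes from the formal point over `F`**: `P = P_F(z(P))`
(injectivity of `z` on `E₁(Ω)`). [cite: SilvermanAEC2009, Prop. VII.2.2] -/
theorem eq_map_ptOf_of_zCoord_mem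
    [hintΩ : ((M.map (PadicInt.Coe.ringHom (p := p))).baseChange (PadicAlgCl p)).IsIntegral (Valued.v (R := PadicAlgCl p)).integer]
    [hint : (curveK p F M).IsIntegral (NormedField.valuation (K := F)).integer]
    {P : ((M.map (PadicInt.Coe.ringHom (p := p))).baseChange (PadicAlgCl p)).toAffine.Point}
    (hP : P ∈ kernel (Valued.v (R := PadicAlgCl p)) ((M.map (PadicInt.Coe.ringHom (p := p))).baseChange (PadicAlgCl p)))
    (hz : P.zCoord ∈ F) (hz1 : ‖((⟨P.zCoord, hz⟩ : F) : F)‖ < 1) :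
    P = Affine.Point.map (W' := M.map (PadicInt.Coe.ringHom (p := p))) (IntermediateField.val F)
      (ptOf p F M ⟨⟨P.zCoord, hz⟩, (mem_unitBall_iff F).mpr hz1.le⟩ hz1) := by
  refine zCoord_injOn hP ((map_val_mem_kernel_iff M F _).mpr (ptOf_mem_kernel _)) ?_
  rw [zCoord_map_val, zCoord_ptOf]

omit hE [CompleteSpace F] in
/-- `‖z(P)‖ < 1` on `E₁(Ω)`, read in `F`. [folklore] -/
theorem norm_zCoord_lt_one_of_mem
    [hintΩ : ((M.map (PadicInt.Coe.ringHom (p := p))).baseChange (PadicAlgCl p)).IsIntegral (Valued.v (R := PadicAlgCl p)).integer]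
    {P : ((M.map (PadicInt.Coe.ringHom (p := p))).baseChange (PadicAlgCl p)).toAffine.Point}
    (hP : P ∈ kernel (Valued.v (R := PadicAlgCl p)) ((M.map (PadicInt.Coe.ringHom (p := p))).baseChange (PadicAlgCl p)))
    (hz : P.zCoord ∈ F) : ‖((⟨P.zCoord, hz⟩ : F) : F)‖ < 1 := by
  have h := val_zCoord_lt_one hP
  rw [PadicAlgCl.valuation_def, ← NNReal.coe_lt_coe, coe_nnnorm, NNReal.coe_one] at h
  exact h

end Subfield

/-! ## §2 The series `ψ(t) = ∑ ψₙ tⁿ` summed in `Ω` -/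

section Series

variable {ψ : ℚ_[p]⟦X⟧} (hψ : ∀ n, ‖coeff n ψ‖ ≤ 1)

/-- The coefficients of `liftInt ψ` are those of `ψ`. [folklore] -/
theorem coe_coeff_liftInt (n : ℕ) : ((coeff n (liftInt ψ hψ) : ℤ_[p]) : ℚ_[p]) = coeff n ψ := by
  rw [liftInt, coeff_mk]

/-- **`ψ(t)` computed in a complete subfield `F ∋ t` is `∑ ψₙ tⁿ` in `Ω`** (the tree's `hasSum_ev₁` pushed along the continuous
inclusion `F ⊂ Ω`). [cite: SilvermanAEC2009, IV.1] -/
theorem val_ev₁_liftInt_eq_tsum (F : IntermediateField ℚ_[p] (PadicAlgCl p)) [CompleteSpace F]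
    {t : unitBall F} (ht : ‖(t : F)‖ < 1) :
    (((ev₁ p F t (hasEval_of_norm_lt_one ht) (liftInt ψ hψ) : unitBall F) : F) : PadicAlgCl p) =
      ∑' n : ℕ, algebraMap ℚ_[p] (PadicAlgCl p) (coeff n ψ) * ((t : F) : PadicAlgCl p) ^ n := by
  have h := (hasSum_ev₁ (K := F) (hasEval_of_norm_lt_one ht) (liftInt ψ hψ)).map
    (IntermediateField.val F) continuous_subtype_val
  have e : ((IntermediateField.val F) ∘ fun n : ℕ ↦
      algebraMap ℚ_[p] F ((coeff n (liftInt ψ hψ) : ℤ_[p]) : ℚ_[p]) * (t : F) ^ n) =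
      fun n : ℕ ↦ algebraMap ℚ_[p] (PadicAlgCl p) (coeff n ψ) * ((t : F) : PadicAlgCl p) ^ n := by
    funext n
    simp only [Function.comp_apply, map_mul, map_pow, AlgHom.commutes, coe_coeff_liftInt]
    rfl
  have h' := e ▸ h
  exact h'.tsum_eq.symm

include hψ in
/-- **`σ(∑ ψₙ tⁿ) = ∑ ψₙ (σt)ⁿ` for `σ ∈ Aut(Ω/ℚ_p)` and `‖t‖ < 1`** (coefficients in `ℚ_p`; `σ` is an isometry, Mathlib
`spectralNorm_eq_of_equiv`, hence continuous; summability through the complete subfield `ℚ_p(t)`). [folklore] -/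
theorem algEquiv_tsum (σ : PadicAlgCl p ≃ₐ[ℚ_[p]] PadicAlgCl p) {t : PadicAlgCl p} (ht : ‖t‖ < 1) :
    σ (∑' n : ℕ, algebraMap ℚ_[p] (PadicAlgCl p) (coeff n ψ) * t ^ n) =
      ∑' n : ℕ, algebraMap ℚ_[p] (PadicAlgCl p) (coeff n ψ) * (σ t) ^ n := by
  -- summability in `Ω` via the complete subfield `ℚ_p(t)`
  set F : IntermediateField ℚ_[p] (PadicAlgCl p) := IntermediateField.adjoin ℚ_[p] {t} with hF
  haveI : FiniteDimensional ℚ_[p] F := IntermediateField.adjoin.finiteDimensional (Algebra.IsIntegral.isIntegral t)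
  haveI : CompleteSpace F := FiniteDimensional.complete ℚ_[p] F
  have htF : t ∈ F := IntermediateField.mem_adjoin_simple_self ℚ_[p] t
  set t' : unitBall F := ⟨⟨t, htF⟩, (mem_unitBall_iff F).mpr (show ‖((⟨t, htF⟩ : F) : F)‖ ≤ 1 from ht.le)⟩
  have ht' : ‖(t' : F)‖ < 1 := ht
  have hs : HasSum (fun n : ℕ ↦ algebraMap ℚ_[p] (PadicAlgCl p) (coeff n ψ) * t ^ n)
      (∑' n : ℕ, algebraMap ℚ_[p] (PadicAlgCl p) (coeff n ψ) * t ^ n) := by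
    have h := (hasSum_ev₁ (K := F) (hasEval_of_norm_lt_one ht') (liftInt ψ hψ)).map
      (IntermediateField.val F) continuous_subtype_val
    have e : ((IntermediateField.val F) ∘ fun n : ℕ ↦
        algebraMap ℚ_[p] F ((coeff n (liftInt ψ hψ) : ℤ_[p]) : ℚ_[p]) * (t' : F) ^ n) =
        fun n : ℕ ↦ algebraMap ℚ_[p] (PadicAlgCl p) (coeff n ψ) * t ^ n := by
      funext n
      simp only [Function.comp_apply, map_mul, map_pow, AlgHom.commutes, coe_coeff_liftInt]
      rfl
    have h' := e ▸ h
    exact h'.tsum_eq ▸ h'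
  -- `σ` is an isometry, hence continuous
  have hσc : Continuous σ := by
    refine AddMonoidHomClass.continuous_of_bound σ 1 fun x ↦ ?_
    rw [one_mul, ← PadicAlgCl.spectralNorm_eq, ← PadicAlgCl.spectralNorm_eq]
    exact (spectralNorm_eq_of_equiv σ x).symm.le
  have h2 := hs.map σ hσc
  have e2 : (σ : PadicAlgCl p → PadicAlgCl p) ∘ (fun n : ℕ ↦ algebraMap ℚ_[p] (PadicAlgCl p) (coeff n ψ) * t ^ n) =
      fun n : ℕ ↦ algebraMap ℚ_[p] (PadicAlgCl p) (coeff n ψ) * (σ t) ^ n := by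
    funext n
    simp only [Function.comp_apply, map_mul, map_pow, AlgEquiv.commutes]
  rw [e2] at h2
  exact h2.tsum_eq.symm

end Series

/-! ## §3 The Honda map `Φ : E₁(W ⊗ Ω) → E₁(A ⊗ Ω)` -/

section HondaMap

variable (MW MA : WeierstrassCurve ℤ_[p]) [hEW : (MW.map PadicInt.Coe.ringHom).IsElliptic]
  [hEA : (MA.map PadicInt.Coe.ringHom).IsElliptic]
  [hintW : ((MW.map (PadicInt.Coe.ringHom (p := p))).baseChange (PadicAlgCl p)).IsIntegral (Valued.v (R := PadicAlgCl p)).integer]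
  [hintA : ((MA.map (PadicInt.Coe.ringHom (p := p))).baseChange (PadicAlgCl p)).IsIntegral (Valued.v (R := PadicAlgCl p)).integer]
  {ψ : ℚ_[p]⟦X⟧} (hψ0 : constantCoeff ψ = 0) (hψ : ∀ n, ‖coeff n ψ‖ ≤ 1)
  (hlog : (MA.map (PadicInt.Coe.ringHom (p := p))).formalLog.subst ψ = (MW.map (PadicInt.Coe.ringHom (p := p))).formalLog)

omit hEA hintW in
/-- **`E₁(Ω)` is stable under `Aut(Ω/ℚ_p)`** (`σ` is an isometry: `‖σ x‖ = ‖x‖`, Mathlib `spectralNorm_eq_of_equiv`).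
[cite: SilvermanAEC2009, VII.§2] -/
theorem pointMap_mem_kernel_iff (M : WeierstrassCurve ℤ_[p])
    [((M.map (PadicInt.Coe.ringHom (p := p))).baseChange (PadicAlgCl p)).IsIntegral (Valued.v (R := PadicAlgCl p)).integer]
    (σ : PadicAlgCl p ≃ₐ[ℚ_[p]] PadicAlgCl p)
    (Q : ((M.map (PadicInt.Coe.ringHom (p := p))).baseChange (PadicAlgCl p)).toAffine.Point) :
    Affine.Point.map (σ : PadicAlgCl p →ₐ[ℚ_[p]] PadicAlgCl p) Q ∈
        kernel (Valued.v (R := PadicAlgCl p)) ((M.map (PadicInt.Coe.ringHom (p := p))).baseChange (PadicAlgCl p)) ↔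
      Q ∈ kernel (Valued.v (R := PadicAlgCl p)) ((M.map (PadicInt.Coe.ringHom (p := p))).baseChange (PadicAlgCl p)) := by
  rcases Q with _ | ⟨x, y, h⟩
  · exact Iff.rfl
  · rw [Affine.Point.map_some, some_mem_kernel_iff, some_mem_kernel_iff, PadicAlgCl.valuation_def, PadicAlgCl.valuation_def,
      ← NNReal.coe_lt_coe, ← NNReal.coe_lt_coe, coe_nnnorm, coe_nnnorm]
    change 1 < ‖σ x‖ ↔ 1 < ‖x‖
    rw [← PadicAlgCl.spectralNorm_eq p (σ x), ← PadicAlgCl.spectralNorm_eq p x, spectralNorm_eq_of_equiv σ x]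

include hEW hψ0 hψ hlog in
/-- **The Honda map on `E₁(Ω)`.** For `M_W, M_A / ℤ_p` with elliptic generic fibres and `ψ ∈ Xℤ_p⟦X⟧` with
`log_A ∘ ψ = log_W`, there is an additive `Φ : E₁(W ⊗ Ω) → (A ⊗ Ω)(Ω)` with values in `E₁(A ⊗ Ω)`, characterised by
`z(Φ P) = ∑ ψₙ z(P)ⁿ`, INJECTIVE and `Aut(Ω/ℚ_p)`-EQUIVARIANT. (Kobayashi §8.4 / Kim Prop. 2.11–2.12: `Ê(𝔪̄) ≅ Ê'(𝔪̄)` as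
Galois modules when `a_p(E) = a_p(E')`.) [cite: Kobayashi2003, §8.4] [cite: BDKim2009, Prop. 2.11–2.12 (p. 186)]
[cite: SilvermanAEC2009, Prop. VII.2.2] -/
theorem exists_hondaMapΩ :
    ∃ Φ : ↥(kernel (Valued.v (R := PadicAlgCl p)) ((MW.map (PadicInt.Coe.ringHom (p := p))).baseChange (PadicAlgCl p))) →+
        ((MA.map (PadicInt.Coe.ringHom (p := p))).baseChange (PadicAlgCl p)).toAffine.Point,
      (∀ P, Φ P ∈ kernel (Valued.v (R := PadicAlgCl p)) ((MA.map (PadicInt.Coe.ringHom (p := p))).baseChange (PadicAlgCl p))) ∧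
      (∀ P, (Φ P).zCoord = ∑' n : ℕ, algebraMap ℚ_[p] (PadicAlgCl p) (coeff n ψ) *
        (P : ((MW.map (PadicInt.Coe.ringHom (p := p))).baseChange (PadicAlgCl p)).toAffine.Point).zCoord ^ n) ∧
      Function.Injective Φ ∧
      (∀ (σ : PadicAlgCl p ≃ₐ[ℚ_[p]] PadicAlgCl p)
        (P : ↥(kernel (Valued.v (R := PadicAlgCl p)) ((MW.map (PadicInt.Coe.ringHom (p := p))).baseChange (PadicAlgCl p))))
        (hσP : Affine.Point.map (σ : PadicAlgCl p →ₐ[ℚ_[p]] PadicAlgCl p)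
          (P : ((MW.map (PadicInt.Coe.ringHom (p := p))).baseChange (PadicAlgCl p)).toAffine.Point) ∈
          kernel (Valued.v (R := PadicAlgCl p)) ((MW.map (PadicInt.Coe.ringHom (p := p))).baseChange (PadicAlgCl p))),
        Φ ⟨_, hσP⟩ = Affine.Point.map (σ : PadicAlgCl p →ₐ[ℚ_[p]] PadicAlgCl p) (Φ P)) := by
  -- notation
  set VW := (MW.map (PadicInt.Coe.ringHom (p := p))).baseChange (PadicAlgCl p) with hVW
  set VA := (MA.map (PadicInt.Coe.ringHom (p := p))).baseChange (PadicAlgCl p) with hVA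
  set kerW := kernel (Valued.v (R := PadicAlgCl p)) VW with hkerW
  set kerA := kernel (Valued.v (R := PadicAlgCl p)) VA with hkerA
  set Z : PadicAlgCl p → PadicAlgCl p := fun t ↦ ∑' n : ℕ, algebraMap ℚ_[p] (PadicAlgCl p) (coeff n ψ) * t ^ n with hZ
  have hψℤ0 : constantCoeff (liftInt ψ hψ) = 0 := (constantCoeff_liftInt_eq_zero_and_coeff_one MW MA hψ0 hψ hlog).1
  have hhom := subst_formalGroupLaw_eq MW MA hψ0 hψ hlog
  obtain ⟨ψ', hψ'0, hψ'inv, -⟩ := exists_substInv_liftInt MW MA hψ0 hψ hlog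
  -- uniqueness in `E₁(A ⊗ Ω)` by the parameter
  have huniq : ∀ {R R' : VA.toAffine.Point}, R ∈ kerA → R' ∈ kerA → R.zCoord = R'.zCoord → R = R' :=
    fun hR hR' h ↦ zCoord_injOn hR hR' h
  -- the candidate over a complete subfield `F ∋ z(P)`: for `P = val P_F(t)`, `R_F = val (P_A(ψ(t)))`
  have hcand : ∀ (F : IntermediateField ℚ_[p] (PadicAlgCl p)) [CompleteSpace F]
      (t : unitBall F) (ht : ‖(t : F)‖ < 1),
      Affine.Point.map (W' := MA.map (PadicInt.Coe.ringHom (p := p))) (IntermediateField.val F)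
          (ptOf p F MA (ev₁ p F t (hasEval_of_norm_lt_one ht) (liftInt ψ hψ)) (norm_ev₁_liftInt_lt_one hψ hψℤ0 ht)) ∈ kerA ∧
        (Affine.Point.map (W' := MA.map (PadicInt.Coe.ringHom (p := p))) (IntermediateField.val F)
          (ptOf p F MA (ev₁ p F t (hasEval_of_norm_lt_one ht) (liftInt ψ hψ)) (norm_ev₁_liftInt_lt_one hψ hψℤ0 ht))).zCoord =
          Z ((t : F) : PadicAlgCl p) := by
    intro F _ t ht
    haveI := isIntegral_curveK p F MA
    refine ⟨(map_val_mem_kernel_iff MA F _).mpr (ptOf_mem_kernel _), ?_⟩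
    rw [zCoord_map_val, zCoord_ptOf, val_ev₁_liftInt_eq_tsum hψ F ht]
  -- every `P ∈ E₁(W ⊗ Ω)` is `val P_F(t)` for `F = ℚ_p(z P)`, `t = z P`
  have hpar : ∀ P : ↥kerW, ∃ (F : IntermediateField ℚ_[p] (PadicAlgCl p)) (_ : CompleteSpace F)
      (t : unitBall F) (ht : ‖(t : F)‖ < 1), ((t : F) : PadicAlgCl p) = (P : VW.toAffine.Point).zCoord ∧
      (P : VW.toAffine.Point) =
        Affine.Point.map (W' := MW.map (PadicInt.Coe.ringHom (p := p))) (IntermediateField.val F) (ptOf p F MW t ht) := by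
    intro P
    set z := (P : VW.toAffine.Point).zCoord with hz
    set F : IntermediateField ℚ_[p] (PadicAlgCl p) := IntermediateField.adjoin ℚ_[p] {z} with hF
    haveI : FiniteDimensional ℚ_[p] F := IntermediateField.adjoin.finiteDimensional (Algebra.IsIntegral.isIntegral z)
    haveI : CompleteSpace F := FiniteDimensional.complete ℚ_[p] F
    haveI := isIntegral_curveK p F MW
    have hzF : z ∈ F := IntermediateField.mem_adjoin_simple_self ℚ_[p] z
    have hz1 := norm_zCoord_lt_one_of_mem MW F P.2 hzF
    exact ⟨F, inferInstance, ⟨⟨z, hzF⟩, (mem_unitBall_iff F).mpr hz1.le⟩, hz1, rfl,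
      eq_map_ptOf_of_zCoord_mem MW F P.2 hzF hz1⟩
  -- existence for every `P ∈ E₁(W ⊗ Ω)`
  have hex : ∀ P : ↥kerW, ∃ R : VA.toAffine.Point, R ∈ kerA ∧ R.zCoord = Z (P : VW.toAffine.Point).zCoord := by
    intro P
    obtain ⟨F, _, t, ht, htz, -⟩ := hpar P
    obtain ⟨h1, h2⟩ := hcand F t ht
    exact ⟨_, h1, by rw [h2, htz]⟩
  choose Φf hΦk hΦz using hex
  -- the candidate computes `Φf`
  have hΦF : ∀ (F : IntermediateField ℚ_[p] (PadicAlgCl p)) [CompleteSpace F] (P : ↥kerW)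
      (t : unitBall F) (ht : ‖(t : F)‖ < 1)
      (hPt : (P : VW.toAffine.Point) =
        Affine.Point.map (W' := MW.map (PadicInt.Coe.ringHom (p := p))) (IntermediateField.val F) (ptOf p F MW t ht)),
      Φf P = Affine.Point.map (W' := MA.map (PadicInt.Coe.ringHom (p := p))) (IntermediateField.val F)
          (ptOf p F MA (ev₁ p F t (hasEval_of_norm_lt_one ht) (liftInt ψ hψ)) (norm_ev₁_liftInt_lt_one hψ hψℤ0 ht)) := by
    intro F _ P t ht hPt
    obtain ⟨h1, h2⟩ := hcand F t ht
    refine huniq (hΦk P) h1 ?_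
    rw [hΦz P, h2, hPt, zCoord_map_val, zCoord_ptOf]
  -- additivity
  have hadd : ∀ P Q : ↥kerW, Φf (P + Q) = Φf P + Φf Q := by
    intro P Q
    set zP := (P : VW.toAffine.Point).zCoord with hzP
    set zQ := (Q : VW.toAffine.Point).zCoord with hzQ
    set F : IntermediateField ℚ_[p] (PadicAlgCl p) := IntermediateField.adjoin ℚ_[p] {zP, zQ} with hF
    haveI : FiniteDimensional ℚ_[p] F :=
      IntermediateField.finiteDimensional_adjoin fun x _ ↦ Algebra.IsIntegral.isIntegral x
    haveI : CompleteSpace F := FiniteDimensional.complete ℚ_[p] F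
    haveI := isIntegral_curveK p F MW
    haveI := isIntegral_curveK p F MA
    have hzPF : zP ∈ F := IntermediateField.subset_adjoin ℚ_[p] _ (by simp)
    have hzQF : zQ ∈ F := IntermediateField.subset_adjoin ℚ_[p] _ (by simp)
    have hzP1 := norm_zCoord_lt_one_of_mem MW F P.2 hzPF
    have hzQ1 := norm_zCoord_lt_one_of_mem MW F Q.2 hzQF
    set tP : unitBall F := ⟨⟨zP, hzPF⟩, (mem_unitBall_iff F).mpr hzP1.le⟩ with htP
    set tQ : unitBall F := ⟨⟨zQ, hzQF⟩, (mem_unitBall_iff F).mpr hzQ1.le⟩ with htQ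
    have hPP₀ : (P : VW.toAffine.Point) =
        Affine.Point.map (W' := MW.map (PadicInt.Coe.ringHom (p := p))) (IntermediateField.val F) (ptOf p F MW tP hzP1) :=
      eq_map_ptOf_of_zCoord_mem MW F P.2 hzPF hzP1
    have hQQ₀ : (Q : VW.toAffine.Point) =
        Affine.Point.map (W' := MW.map (PadicInt.Coe.ringHom (p := p))) (IntermediateField.val F) (ptOf p F MW tQ hzQ1) :=
      eq_map_ptOf_of_zCoord_mem MW F Q.2 hzQF hzQ1
    -- `P + Q = val P_F(F_W(tP, tQ))`
    have e1 : Affine.Point.map (W' := MW.map (PadicInt.Coe.ringHom (p := p))) (IntermediateField.val F)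
          (ptOf p F MW tP hzP1 + ptOf p F MW tQ hzQ1) =
        Affine.Point.map (W' := MW.map (PadicInt.Coe.ringHom (p := p))) (IntermediateField.val F) (ptOf p F MW tP hzP1) +
          Affine.Point.map (W' := MW.map (PadicInt.Coe.ringHom (p := p))) (IntermediateField.val F) (ptOf p F MW tQ hzQ1) :=
      map_add _ _ _
    have hsumW : ptOf p F MW (evF p MW tP tQ hzP1 hzQ1) (norm_evF_lt_one hzP1 hzQ1) =
        ptOf p F MW tP hzP1 + ptOf p F MW tQ hzQ1 := by
      convert (ptOf_add (p := p) (M := MW) (u := tP) (v := tQ) hzP1 hzQ1).symm using 4; rfl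
    have hPQ : ((P + Q : ↥kerW) : VW.toAffine.Point) =
        Affine.Point.map (W' := MW.map (PadicInt.Coe.ringHom (p := p))) (IntermediateField.val F)
          (ptOf p F MW (evF p MW tP tQ hzP1 hzQ1) (norm_evF_lt_one hzP1 hzQ1)) := by
      rw [hsumW, e1, ← hPP₀, ← hQQ₀]; rfl
    rw [hΦF F (P + Q) _ _ hPQ, hΦF F P tP hzP1 hPP₀, hΦF F Q tQ hzQ1 hQQ₀]
    -- `P_A(ψ(F_W(tP,tQ))) = P_A(F_A(ψ tP, ψ tQ)) = P_A(ψ tP) + P_A(ψ tQ)`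
    have e2 : ptOf p F MA (ev₁ p F (evF p MW tP tQ hzP1 hzQ1) (hasEval_of_norm_lt_one (norm_evF_lt_one hzP1 hzQ1))
          (liftInt ψ hψ)) (norm_ev₁_liftInt_lt_one hψ hψℤ0 (norm_evF_lt_one hzP1 hzQ1)) =
        ptOf p F MA (ev₁ p F tP (hasEval_of_norm_lt_one hzP1) (liftInt ψ hψ)) (norm_ev₁_liftInt_lt_one hψ hψℤ0 hzP1) +
          ptOf p F MA (ev₁ p F tQ (hasEval_of_norm_lt_one hzQ1) (liftInt ψ hψ)) (norm_ev₁_liftInt_lt_one hψ hψℤ0 hzQ1) := by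
      have hsumA := (ptOf_add (p := p) (M := MA) (norm_ev₁_liftInt_lt_one hψ hψℤ0 (t := tP) hzP1)
        (norm_ev₁_liftInt_lt_one hψ hψℤ0 (t := tQ) hzQ1)).symm
      rw [ptOf_congr (coe_ev₁_evF MW MA hψ hψℤ0 hhom (u := tP) (v := tQ) hzP1 hzQ1) _ (norm_evF_lt_one
        (norm_ev₁_liftInt_lt_one hψ hψℤ0 (t := tP) hzP1) (norm_ev₁_liftInt_lt_one hψ hψℤ0 (t := tQ) hzQ1))]
      convert hsumA using 4; rfl
    rw [e2]
    exact map_add _ _ _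
  -- the homomorphism
  let Φ : ↥kerW →+ VA.toAffine.Point := AddMonoidHom.mk' Φf hadd
  have hΦ : ∀ P, Φ P = Φf P := fun P ↦ rfl
  refine ⟨Φ, fun P ↦ hΦk P, fun P ↦ hΦz P, ?_, ?_⟩
  · -- injectivity
    rw [injective_iff_map_eq_zero]
    intro P hP0
    obtain ⟨F, _, t, ht, htz, hPt⟩ := hpar P
    haveI := isIntegral_curveK p F MW
    haveI := isIntegral_curveK p F MA
    rw [hΦ, hΦF F P t ht hPt] at hP0
    have h0 : ptOf p F MA (ev₁ p F t (hasEval_of_norm_lt_one ht) (liftInt ψ hψ)) (norm_ev₁_liftInt_lt_one hψ hψℤ0 ht) = 0 :=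
      Affine.Point.map_injective (W' := MA.map (PadicInt.Coe.ringHom (p := p))) _ (by
        rw [hP0]; exact (map_zero _).symm)
    -- `ψ(t) = 0`, hence `t = ψ'(ψ t) = ψ'(0) = 0`
    have hz : ((ev₁ p F t (hasEval_of_norm_lt_one ht) (liftInt ψ hψ) : unitBall F) : F) = 0 := by
      have := congrArg Affine.Point.zCoord h0
      rwa [zCoord_ptOf, Affine.Point.zCoord_zero] at this
    have hz' : ev₁ p F t (hasEval_of_norm_lt_one ht) (liftInt ψ hψ) = 0 := Subtype.ext hz
    have h00 : ‖((0 : unitBall F) : F)‖ < 1 := by simp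
    have h' : ev₁ p F (0 : unitBall F) (hasEval_of_norm_lt_one h00) ψ' = t := by
      rw [← coe_ev₁_ev₁_of_subst_eq_X hψ hψℤ0 hψ'inv ht]; exact (ev₁_congr hz' _ _ _).symm
    have hnorm : ‖((ev₁ p F (0 : unitBall F) (hasEval_of_norm_lt_one h00) ψ' : unitBall F) : F)‖ ≤ ‖((0 : unitBall F) : F)‖ :=
      norm_ev₁_le _ h00.le hψ'0
    have ht0 : (t : F) = 0 := by
      rw [← h']
      have : ‖((0 : unitBall F) : F)‖ = 0 := by simp
      rw [this] at hnorm
      exact norm_le_zero_iff.mp hnorm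
    have e0 : Affine.Point.map (W' := MW.map (PadicInt.Coe.ringHom (p := p))) (IntermediateField.val F)
        (0 : (curveK p F MW).toAffine.Point) = 0 := map_zero _
    apply Subtype.ext
    rw [hPt, ptOf_of_eq_zero ht ht0, e0]
    rfl
  · -- equivariance
    intro σ P hσP
    refine huniq (hΦk _) ((pointMap_mem_kernel_iff MA σ _).mpr (hΦk P)) ?_
    rw [hΦ, hΦ, hΦz, zCoord_pointMap, zCoord_pointMap, hΦz]
    have hz1 : ‖(P : VW.toAffine.Point).zCoord‖ < 1 := by
      have h := val_zCoord_lt_one P.2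
      rw [PadicAlgCl.valuation_def, ← NNReal.coe_lt_coe, coe_nnnorm, NNReal.coe_one] at h
      exact h
    exact (algEquiv_tsum hψ σ hz1).symm

end HondaMap

end Summit.BirchSwinnertonDyer.BirchSwinnertonDyer.Theorems.SignedTransportAtTwo

end
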